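import Summits.QuantumFields.BalabanUV.Beta.RemainderExplicitHistoryDiagonalExistence

/-!
# RemainderExplicitHistoryDiagonalUniform — ROAD P3: WHEN ARE THE DIAGONAL SUMS BOUNDED UNIFORMLY IN THE INFRARED DISTANCE? — the
# m-UNIFORM fixed point of station S-d4p3-g47-1: with a CUTOFF-DEPENDENT source `σ K l` (the scale shift read ON THE RUN, not on the box)
# whose windowed diagonal sums are bounded by `S₀` uniformly in `m`, a summable memory profile `Σρ ≤ W` and weights with `Σ_n u_n ≤ U`
# (node U2's K-uniform AF weight SUM), `WU < 1`: `Σ_{n<N} δ (n+m) n ≤ S₀∕(1 − WU)` for EVERY `m` — the run-level END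
# `sum_disc_diag_le_run` and the m-uniform closeness `|invSq g m n − astar g m| ≤ S₀∕(1 − W(γ³ + 2γ∕b))` (seventh file of the station)

Cell `pub-balaban`, β-function sub-cell, BINDER row D4 «RemainderConst leaves for Bałaban's split» (`HOME/BINDER-OWNERS.md`; owner
lineage `b2b-balaban-beta-an4`; this file by co-owner #3 lineage `b2b-balaban-beta-d4-p3`, road P3 «the reduction road», generation 47,
station S-d4p3-g47-1, seventh file; imports the station's `RemainderExplicitHistoryDiagonalExistence`), β-FLOW TEAM duty (1); FREEZE (0)
honoured (def-free module in road P3's own `RemainderExplicit*` series; no leaf, no interface, no Literature file).  SOURCE OF THE SHAPES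
ONLY: [Balaban1987RG1] (0.20) p. 256, (0.31) and Thm 2 p. 259, §5 p. 298.  Pure real analysis (finite sums).

HONEST FRAMING (page 1 of everything the β sub-cell writes).  *"Discharging BetaPertH makes Bałaban's UV stability UNCONDITIONAL —
a real constructive-QFT result; it is NOT the continuum limit and NOT the Clay problem."*  THIS FILE DISCHARGES NOTHING OF THE
KIND.  The station's kernel `RemainderExplicitHistoryDiagonalKernel.diag_sum_le` is LINEAR in the infrared distance `m` because a BOX-level
scale-shift profile `σ_l` is counted once by each of the `m` cutoffs whose window contains the scale `l` (`m·S` exactly); no box-level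
hypothesis can do better.  This file records the complementary mechanism: if the source is read ON THE RUNS — `σ K l` = the scale shift
`|β_{l+2}(g^{(K+1)}_0,…,g^{(K+1)}_{l+1}) − β_{l+1}(g^{(K+1)}_1,…,g^{(K+1)}_{l+1})|` of the run with cutoff `K + 1` itself, which along
asymptotically free runs is small at BOTH ends — and its windowed diagonal sums `Σ_{n<L∸m} Σ_{l∈[n,n+m)} σ (n+m) l` are bounded by `S₀`
UNIFORMLY in `m` (a property of the runs, to be checked family by family; nothing here asserts it for any β), then the plain maximum
`Q′ = max_m F_m` closes against node U2's K-uniform weight SUM `U = γ³ + 2γ∕b` (the window masses are `≤ W`, no counting): the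
discrepancy diagonal sums are `≤ S₀∕(1 − WU)` for every `m`, and the closeness of the continuum coupling is m-uniform.  Every hypothesis on
`β` and on the runs is a binder; nothing of Bałaban's (1.22) is asserted or constructed; row D4 class UNCHANGED (critical-path width 0;
instance 0∕1; D4 DISCHARGE NO DATE); NOT B12 Thm 2, NOT BetaPertH, NOT continuum, NOT Clay.  HONEST DEPENDENCY: continuum YM on T⁴ ⇐
BetaPertH ∧ nine spine estimates (0/9 proved); BetaPertH ⇐ (D1) ∧ (D4) ∧ CAP+tail; G-an2-4 gates asym, D1 and NE2/3/4.  ABSOLUTE RULE: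
nothing is cited as a fact.

WHAT IS PROVED ([folklore]; 0 sorry; 0 `def`).
* §1 THE m-UNIFORM KERNEL over abstract nonnegative arrays with a cutoff-dependent source `σ K l`: `diag_entry_src`, `diag_system_src`
  (`F m ≤ src L m + Σ_{m″<L} (Σ_{a∈[m″+1∸m, m″+1)} ρ_a)·u_{m″+1}·F (m″+1)`), **`diag_sum_le_uniform`** (`src L m ≤ S₀` for all `L, m`,
  `Σ_{a<n} ρ_a ≤ W`, `Σ_{m″<L} u_{m″+1} ≤ U`, `WU < 1` ⟹ `Σ_{n<N} δ (n+m) n ≤ S₀∕(1 − WU)` for EVERY `m`: window masses `≤ W`, no counting,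
  the plain maximum `Q′ ≤ S₀ + Q′·W·U`).
* §2 RUN LEVEL: `disc_step_run` (node U2's step with the scale shift READ ON RUN B, no box supremum), `disc_le_sum_run`,
  `sum_weights_ir_le` (`Σ_{m″<L} u_{m″+1} ≤ γ³ + 2γ∕b` for `u_n = 1∕(a_n√a_n)`: node U2's `sum_profWeights_le` BY NAME, reflected).
* §3 ENDs **`sum_disc_diag_le_run`** (pinned family of runs; the RUN-LEVEL windowed source bound `S₀` as a displayed hypothesis on the runs;
  memory profile `Σρ ≤ W`; floor `BetaLowerH b γ β`; smallness `W(γ³ + 2γ∕b) < 1` ⟹ `Σ_{n<N} disc (g (n+m)) (g (n+m+1)) n ≤ S₀∕(1 − W(γ³ + 2γ∕b))`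
  for EVERY `m`) and **`tendsto_invSq_diag_run`** (`invSq g m n → astar g m` with the m-UNIFORM closeness `≤ S₀∕(1 − W(γ³ + 2γ∕b))`).
All letters NOT-IN-PRINT; `BetaFlowAsPrinted S` records a Markov β_n only ⇒ no junction of the as-printed interface changes.
-/

noncomputable section

open Finset Filter Topology

namespace Summit.QuantumFields.BalabanUV.Beta.RemainderExplicitHistoryDiagonalUniform

open Literature.MathematicalPhysics.QuantumFieldTheory.Balaban1983to89
open Literature.MathematicalPhysics.QuantumFieldTheory.Balaban1983to89.FlowStep
open Literature.MathematicalPhysics.QuantumFieldTheory.Balaban1983to89.T4CouplingMatching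
open Literature.MathematicalPhysics.QuantumFieldTheory.Balaban1983to89.T4ContinuumCoupling
open Summit.QuantumFields.BalabanUV.Beta.RemainderExplicitHistoryDiagonalKernel (sum_filter_diag_le)
open Summit.QuantumFields.BalabanUV.Beta.RemainderExplicitHistoryDiagonalSum
open Summit.QuantumFields.BalabanUV.Beta.RemainderExplicitHistoryDiagonalExistence

/-! ## §1 The m-uniform kernel with a cutoff-dependent source -/

/-- ONE DIAGONAL ENTRY IN DIAGONAL COORDINATES, cutoff-dependent source: for `K = n + m`, `j = n`,
`δ (n+m) n ≤ Σ_{l∈[n,n+m)} σ (n+m) l + Σ_{m″<n+m} (Σ_{a∈[m″+1∸m, m″+1)} ρ_a)·u_{m″+1}·δ (n+m) (n+m−1−m″)`. [folklore] -/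
theorem diag_entry_src {δ σ : ℕ → ℕ → ℝ} {ρ u : ℕ → ℝ}
    (hrec : ∀ K j, j ≤ K → δ K j ≤ (∑ l ∈ Ico j K, σ K l)
      + ∑ i ∈ range K, (∑ a ∈ Ico (j - i) (K - i), ρ a) * u (K - i) * δ K i) (n m : ℕ) :
    δ (n + m) n ≤ (∑ l ∈ Ico n (n + m), σ (n + m) l)
      + ∑ m'' ∈ range (n + m), (∑ a ∈ Ico (m'' + 1 - m) (m'' + 1), ρ a) * u (m'' + 1)
          * δ (n + m) (n + m - 1 - m'') := by
  have h := hrec (n + m) n (Nat.le_add_right n m)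
  have e : ∑ i ∈ range (n + m), (∑ a ∈ Ico (n - i) (n + m - i), ρ a) * u (n + m - i) * δ (n + m) i
      = ∑ m'' ∈ range (n + m), (∑ a ∈ Ico (m'' + 1 - m) (m'' + 1), ρ a) * u (m'' + 1)
          * δ (n + m) (n + m - 1 - m'') := by
    rw [← Finset.sum_range_reflect (fun i => (∑ a ∈ Ico (n - i) (n + m - i), ρ a) * u (n + m - i) * δ (n + m) i)
      (n + m)]
    refine Finset.sum_congr rfl fun m'' hm'' => ?_
    have hm : m'' < n + m := Finset.mem_range.mp hm''
    have e1 : n - (n + m - 1 - m'') = m'' + 1 - m := by omega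
    have e2 : n + m - (n + m - 1 - m'') = m'' + 1 := by omega
    rw [e1, e2]
  rw [e] at h
  exact h

/-- THE DIAGONAL SUMS OBEY A LINEAR SYSTEM, cutoff-dependent source: with `F m := Σ_{n<L∸m} δ (n+m) n`,
`F m ≤ Σ_{n<L∸m} Σ_{l∈[n,n+m)} σ (n+m) l + Σ_{m″<L} (Σ_{a∈[m″+1∸m, m″+1)} ρ_a)·u_{m″+1}·F (m″+1)`. [folklore] -/
theorem diag_system_src {δ σ : ℕ → ℕ → ℝ} {ρ u : ℕ → ℝ}
    (hδ0 : ∀ K j, 0 ≤ δ K j) (hρ0 : ∀ a, 0 ≤ ρ a) (hu0 : ∀ n, 0 ≤ u n)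
    (hrec : ∀ K j, j ≤ K → δ K j ≤ (∑ l ∈ Ico j K, σ K l)
      + ∑ i ∈ range K, (∑ a ∈ Ico (j - i) (K - i), ρ a) * u (K - i) * δ K i) (L m : ℕ) :
    ∑ n ∈ range (L - m), δ (n + m) n ≤ (∑ n ∈ range (L - m), ∑ l ∈ Ico n (n + m), σ (n + m) l)
      + ∑ m'' ∈ range L, (∑ a ∈ Ico (m'' + 1 - m) (m'' + 1), ρ a) * u (m'' + 1)
          * ∑ n' ∈ range (L - (m'' + 1)), δ (n' + m'' + 1) n' := by
  classical
  have hentry : ∀ n ∈ range (L - m), δ (n + m) n ≤ (∑ l ∈ Ico n (n + m), σ (n + m) l)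
      + ∑ m'' ∈ range L, if m'' < n + m then
          (∑ a ∈ Ico (m'' + 1 - m) (m'' + 1), ρ a) * u (m'' + 1) * δ (n + m) (n + m - 1 - m'') else 0 := by
    intro n hn
    have hnL : n + m ≤ L := by have := Finset.mem_range.mp hn; omega
    refine (diag_entry_src hrec n m).trans (add_le_add le_rfl (le_of_eq ?_))
    rw [← Finset.sum_filter]
    congr 1
    ext m''
    simp only [Finset.mem_range, Finset.mem_filter]
    omega
  refine (Finset.sum_le_sum hentry).trans ?_
  rw [Finset.sum_add_distrib]
  refine add_le_add le_rfl ?_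
  rw [Finset.sum_comm]
  refine Finset.sum_le_sum fun m'' _ => ?_
  rw [← Finset.sum_filter, ← Finset.mul_sum]
  exact mul_le_mul_of_nonneg_left (sum_filter_diag_le hδ0 m m'' L)
    (mul_nonneg (Finset.sum_nonneg fun a _ => hρ0 a) (hu0 _))

/-- **THE m-UNIFORM DIAGONAL KERNEL.**  Nonnegative arrays `δ K j` with the column-form recursion (cutoff-dependent source `σ K l`)
`δ K j ≤ Σ_{l∈[j,K)} σ K l + Σ_{i<K} (Σ_{a∈[j∸i,K−i)} ρ_a)·u_{K−i}·δ K i`, `ρ, u ≥ 0`, windowed diagonal source sums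
`Σ_{n<L∸m} Σ_{l∈[n,n+m)} σ (n+m) l ≤ S₀` for ALL `L, m`, `Σ_{a<n} ρ_a ≤ W`, `Σ_{m″<L} u_{m″+1} ≤ U` for all `L`, and `WU < 1`: then
`Σ_{n<N} δ (n+m) n ≤ S₀∕(1 − WU)` for EVERY `m` and `N` — bounded UNIFORMLY in the infrared distance.  (Every window mass is `≤ W`, so the
plain maximum `Q′ = max_{m≤L} F m` obeys `Q′ ≤ S₀ + Q′·W·U`; compare `diag_sum_le`: there `n·u_n ≤ κ` and a box-level source give `m·S`.)
[folklore] -/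
theorem diag_sum_le_uniform {δ σ : ℕ → ℕ → ℝ} {ρ u : ℕ → ℝ} {S₀ W U : ℝ}
    (hδ0 : ∀ K j, 0 ≤ δ K j) (hρ0 : ∀ a, 0 ≤ ρ a) (hu0 : ∀ n, 0 ≤ u n)
    (hsrc : ∀ L m, ∑ n ∈ range (L - m), ∑ l ∈ Ico n (n + m), σ (n + m) l ≤ S₀)
    (hρW : ∀ n, ∑ a ∈ range n, ρ a ≤ W) (hU : ∀ L, ∑ m'' ∈ range L, u (m'' + 1) ≤ U) (hq : W * U < 1)
    (hrec : ∀ K j, j ≤ K → δ K j ≤ (∑ l ∈ Ico j K, σ K l)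
      + ∑ i ∈ range K, (∑ a ∈ Ico (j - i) (K - i), ρ a) * u (K - i) * δ K i) :
    ∀ m N : ℕ, ∑ n ∈ range N, δ (n + m) n ≤ S₀ / (1 - W * U) := by
  classical
  have hS0 : 0 ≤ S₀ := by simpa using hsrc 0 0
  have hW0 : 0 ≤ W := by simpa using hρW 0
  have hU0 : 0 ≤ U := by simpa using hU 0
  have hq' : 0 < 1 - W * U := by linarith
  suffices H : ∀ L m : ℕ, ∑ n ∈ range (L - m), δ (n + m) n ≤ S₀ / (1 - W * U) by
    intro m N
    have h := H (N + m) m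
    rwa [Nat.add_sub_cancel] at h
  intro L
  set F : ℕ → ℝ := fun m => ∑ n ∈ range (L - m), δ (n + m) n with hF
  have hF0 : ∀ m, 0 ≤ F m := fun m => Finset.sum_nonneg fun n _ => hδ0 _ _
  have hsys : ∀ m, F m ≤ S₀
      + ∑ m'' ∈ range L, (∑ a ∈ Ico (m'' + 1 - m) (m'' + 1), ρ a) * u (m'' + 1) * F (m'' + 1) := fun m =>
    (diag_system_src hδ0 hρ0 hu0 hrec L m).trans (add_le_add (hsrc L m) le_rfl)
  -- the plain maximum over `m ≤ L` (beyond `L` every `F m = 0`)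
  obtain ⟨m₀, hm₀, hmax⟩ := Finset.exists_max_image (range (L + 1)) F ⟨0, by simp⟩
  set Q : ℝ := F m₀ with hQ
  have hQ0 : 0 ≤ Q := hF0 _
  have hFQ : ∀ m, F m ≤ Q := by
    intro m
    by_cases hmL : m ≤ L
    · exact hmax m (Finset.mem_range.mpr (Nat.lt_succ_of_le hmL))
    · have : L - m = 0 := by omega
      simp only [hF, this, Finset.sum_range_zero]
      exact hQ0
  have hwin : ∑ m'' ∈ range L, (∑ a ∈ Ico (m'' + 1 - m₀) (m'' + 1), ρ a) * u (m'' + 1) * F (m'' + 1) ≤ Q * (W * U) := by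
    calc ∑ m'' ∈ range L, (∑ a ∈ Ico (m'' + 1 - m₀) (m'' + 1), ρ a) * u (m'' + 1) * F (m'' + 1)
        ≤ ∑ m'' ∈ range L, W * u (m'' + 1) * Q := by
          refine Finset.sum_le_sum fun m'' _ => ?_
          have hc : ∑ a ∈ Ico (m'' + 1 - m₀) (m'' + 1), ρ a ≤ W :=
            (Finset.sum_le_sum_of_subset_of_nonneg (fun a ha => Finset.mem_range.mpr (Finset.mem_Ico.mp ha).2)
              (fun a _ _ => hρ0 a)).trans (hρW (m'' + 1))
          exact mul_le_mul (mul_le_mul_of_nonneg_right hc (hu0 _)) (hFQ _) (hF0 _) (mul_nonneg hW0 (hu0 _))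
      _ = (W * Q) * ∑ m'' ∈ range L, u (m'' + 1) := by
          rw [Finset.mul_sum]; exact Finset.sum_congr rfl fun _ _ => by ring
      _ ≤ (W * Q) * U := mul_le_mul_of_nonneg_left (hU L) (mul_nonneg hW0 hQ0)
      _ = Q * (W * U) := by ring
  have hfix : Q ≤ S₀ + Q * (W * U) := (hsys m₀).trans (add_le_add le_rfl hwin)
  have hQle : Q ≤ S₀ / (1 - W * U) := by
    rw [le_div_iff₀ hq']
    nlinarith
  intro m
  exact (hFQ m).trans hQle

/-! ## §2 Run level: the scale shift read on run B -/

/-- **NODE U2's STEP WITH THE SCALE SHIFT READ ON THE RUN** (no supremum over the box): for `j < K`,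
`δ_j ≤ δ_{j+1} + |β_{j+2}(g^B_0,…,g^B_{j+1}) − β_{j+1}(g^B_1,…,g^B_{j+1})| + Σ_{i≤j} Λ j i·(g^A_i)²g^B_{i+1}·δ_i`
(`HistLipschitz Λ γ β`, `Λ ≥ 0`, couplings in ]0,γ]). [cite: Balaban1987RG1, (0.20) p.256] -/
theorem disc_step_run {β : HBeta} {γ : ℝ} {Λ : ℕ → ℕ → ℝ} {K : ℕ} {gA gB : ℕ → ℝ}
    (hA : RGEqH K β gA) (hB : RGEqH (K + 1) β gB)
    (hAbox : ∀ i, i ≤ K → 0 < gA i ∧ gA i ≤ γ) (hBbox : ∀ i, i ≤ K + 1 → 0 < gB i ∧ gB i ≤ γ)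
    (hL : HistLipschitz Λ γ β) (hΛ : ∀ k i, i ≤ k → 0 ≤ Λ k i) {j : ℕ} (hj : j < K) :
    disc gA gB j ≤ disc gA gB (j + 1)
      + |β (j + 1) (prefixOf gB (j + 1)) - β j (Fin.tail (prefixOf gB (j + 1)))|
      + ∑ i ∈ range (j + 1), Λ j i * ((gA i) ^ 2 * gB (i + 1)) * disc gA gB i := by
  have eA := hA j hj
  have eB := hB (j + 1) (by omega)
  have hpA : prefixOf gA j ∈ Box γ j := prefixOf_mem_box hj.le hAbox
  have htail : Fin.tail (prefixOf gB (j + 1)) ∈ Box γ j := by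
    rw [tail_prefixOf]
    exact prefixOf_mem_box (N := K) hj.le fun i hi => hBbox (i + 1) (by omega)
  have h2 := hL j (Fin.tail (prefixOf gB (j + 1))) (prefixOf gA j) htail hpA
  have h3 : ∑ i : Fin (j + 1), Λ j i * |Fin.tail (prefixOf gB (j + 1)) i - prefixOf gA j i|
      ≤ ∑ i ∈ range (j + 1), Λ j i * ((gA i) ^ 2 * gB (i + 1)) * disc gA gB i := by
    rw [Finset.sum_range (fun i => Λ j i * ((gA i) ^ 2 * gB (i + 1)) * disc gA gB i)]
    refine Finset.sum_le_sum fun i _ => ?_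
    have hiK : (i : ℕ) ≤ K := by have := i.isLt; omega
    have hgA := hAbox i hiK
    have hgB := hBbox (i + 1) (by omega)
    simp only [Fin.tail, prefixOf_apply, Fin.val_succ]
    rw [abs_sub_comm, mul_assoc]
    exact mul_le_mul_of_nonneg_left (abs_sub_le_of_inv_sq hgA.1 hgB.1)
      (hΛ j i (Nat.lt_succ_iff.mp i.isLt))
  have key : 1 / gA j ^ 2 - 1 / gB (j + 1) ^ 2
      = (1 / gA (j + 1) ^ 2 - 1 / gB (j + 1 + 1) ^ 2)
        + (β j (prefixOf gA j) - β j (Fin.tail (prefixOf gB (j + 1))))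
        - (β (j + 1) (prefixOf gB (j + 1)) - β j (Fin.tail (prefixOf gB (j + 1)))) := by
    rw [eA, eB]
    ring
  have habs : disc gA gB j ≤ disc gA gB (j + 1)
      + |β j (prefixOf gA j) - β j (Fin.tail (prefixOf gB (j + 1)))|
      + |β (j + 1) (prefixOf gB (j + 1)) - β j (Fin.tail (prefixOf gB (j + 1)))| := by
    simp only [disc]
    rw [key]
    exact (abs_sub _ _).trans (add_le_add (abs_add_le _ _) le_rfl)
  have hcomm : |β j (prefixOf gA j) - β j (Fin.tail (prefixOf gB (j + 1)))|
      = |β j (Fin.tail (prefixOf gB (j + 1))) - β j (prefixOf gA j)| := abs_sub_comm _ _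
  linarith [habs, hcomm, h2, h3]

/-- Summed from the infrared pin, run-level source: for `j ≤ K`,
`δ_j ≤ Σ_{l∈[j,K)} |β_{l+2}(g^B_{0..l+1}) − β_{l+1}(g^B_{1..l+1})| + Σ_{l∈[j,K)} Σ_{i≤l} Λ l i·(g^A_i)²g^B_{i+1}·δ_i`. [folklore] -/
theorem disc_le_sum_run {β : HBeta} {γ : ℝ} {Λ : ℕ → ℕ → ℝ} {K : ℕ} {gA gB : ℕ → ℝ}
    (hA : RGEqH K β gA) (hB : RGEqH (K + 1) β gB)
    (hAbox : ∀ i, i ≤ K → 0 < gA i ∧ gA i ≤ γ) (hBbox : ∀ i, i ≤ K + 1 → 0 < gB i ∧ gB i ≤ γ)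
    (hpin : gA K = gB (K + 1)) (hL : HistLipschitz Λ γ β) (hΛ : ∀ k i, i ≤ k → 0 ≤ Λ k i) {j : ℕ} (hj : j ≤ K) :
    disc gA gB j ≤ (∑ l ∈ Ico j K, |β (l + 1) (prefixOf gB (l + 1)) - β l (Fin.tail (prefixOf gB (l + 1)))|)
      + ∑ l ∈ Ico j K, ∑ i ∈ range (l + 1), Λ l i * ((gA i) ^ 2 * gB (i + 1)) * disc gA gB i := by
  have h := backward_sum (δ := disc gA gB)
    (s := fun l => |β (l + 1) (prefixOf gB (l + 1)) - β l (Fin.tail (prefixOf gB (l + 1)))|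
      + ∑ i ∈ range (l + 1), Λ l i * ((gA i) ^ 2 * gB (i + 1)) * disc gA gB i)
    (le_of_eq (disc_pin hpin)) (fun l hl => by
      have := disc_step_run hA hB hAbox hBbox hL hΛ hl
      linarith) j hj
  simpa [Finset.sum_add_distrib] using h

/-- Node U2's K-UNIFORM AF weight SUM over infrared distances: `Σ_{m″<L} u_{m″+1} ≤ γ³ + 2γ∕b` for `u_n = 1∕(a_n√a_n)`, `a_n = 1∕γ² + b·n`
(`T4CouplingMatching.sum_profWeights_le` BY NAME, reflected; the term `u_0 = γ³` dropped). [cite: Balaban1987RG1, (0.31) p.259] -/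
theorem sum_weights_ir_le {γ b : ℝ} (hγ : 0 < γ) (hb : 0 < b) (L : ℕ) :
    ∑ m'' ∈ range L, 1 / (prof γ b (m'' + 1) * sprof γ b (m'' + 1)) ≤ γ ^ 3 + 2 * γ / b := by
  have h := sum_profWeights_le hγ hb L
  have e : ∀ n, 1 / (sprof γ b n) ^ 2 * (1 / sprof γ b n) = 1 / (prof γ b n * sprof γ b n) := fun n => by
    rw [sprof_sq hγ hb.le, one_div_mul_one_div]
  simp_rw [e] at h
  have hrefl : ∑ j ∈ range (L + 1), 1 / (prof γ b j * sprof γ b j)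
      = ∑ i ∈ range (L + 1), 1 / (prof γ b (L - i) * sprof γ b (L - i)) := by
    rw [← Finset.sum_range_reflect (fun j => 1 / (prof γ b j * sprof γ b j)) (L + 1)]
    refine Finset.sum_congr rfl fun i _ => ?_
    rw [Nat.add_sub_cancel]
  rw [Finset.sum_range_succ'] at hrefl
  have h0 : 0 ≤ 1 / (prof γ b 0 * sprof γ b 0) := weight_nonneg hγ hb.le 0
  linarith

/-! ## §3 ENDs: m-uniform diagonal sums from a run-level windowed source bound -/

/-- **ROAD P3 — m-UNIFORM DIAGONAL SUMS FROM A RUN-LEVEL SOURCE BOUND.**  A family of runs `K ↦ g K` of (0.20) in ]0,γ] pinned at `g_IR`;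
history moduli `HistLipschitz Λ γ β` dominated by a memory PROFILE `0 ≤ Λ k i ≤ ρ(k−i)`, `Σ_{a<n} ρ_a ≤ W`; the floor `BetaLowerH b γ β`
(`b > 0`); SMALLNESS `W·(γ³ + 2γ∕b) < 1`; and — as a displayed HYPOTHESIS ON THE RUNS — the windowed diagonal sums of the scale shift READ
ON THE RUNS are bounded by `S₀` uniformly in the infrared distance:
`Σ_{n<L∸m} Σ_{l∈[n,n+m)} |β_{l+2}(g^{(n+m+1)}_{0..l+1}) − β_{l+1}(g^{(n+m+1)}_{1..l+1})| ≤ S₀` for all `L, m`.  THEN for every `m, N`: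
`Σ_{n<N} disc (g (n+m)) (g (n+m+1)) n ≤ S₀∕(1 − W(γ³ + 2γ∕b))` — bounded UNIFORMLY in `m`.  Nothing asserts the source hypothesis for any β.
[cite: Balaban1987RG1, (0.20) p.256, (0.31) and Thm 2 p.259] -/
theorem sum_disc_diag_le_run {β : HBeta} {γ b S₀ W : ℝ} {ρ : ℕ → ℝ} {Λ : ℕ → ℕ → ℝ} (g : ℕ → ℕ → ℝ) (gIR : ℝ)
    (hγ : 0 < γ) (hb : 0 < b) (hρ0 : ∀ a, 0 ≤ ρ a) (hρW : ∀ n, ∑ a ∈ range n, ρ a ≤ W)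
    (hsmall : W * (γ ^ 3 + 2 * γ / b) < 1)
    (hrun : ∀ K, RGEqH K β (g K)) (hbox : ∀ K i, i ≤ K → 0 < g K i ∧ g K i ≤ γ) (hpin : ∀ K, g K K = gIR)
    (hL : HistLipschitz Λ γ β) (hΛ0 : ∀ k i, i ≤ k → 0 ≤ Λ k i) (hΛρ : ∀ k i, i ≤ k → Λ k i ≤ ρ (k - i))
    (hlo : BetaLowerH b γ β)
    (hsrc : ∀ L m, ∑ n ∈ range (L - m), ∑ l ∈ Ico n (n + m),
      |β (l + 1) (prefixOf (g (n + m + 1)) (l + 1)) - β l (Fin.tail (prefixOf (g (n + m + 1)) (l + 1)))| ≤ S₀)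
    (m N : ℕ) :
    ∑ n ∈ range N, disc (g (n + m)) (g (n + m + 1)) n ≤ S₀ / (1 - W * (γ ^ 3 + 2 * γ / b)) := by
  have hrec : ∀ K j, j ≤ K → disc (g K) (g (K + 1)) j
      ≤ (∑ l ∈ Ico j K, |β (l + 1) (prefixOf (g (K + 1)) (l + 1)) - β l (Fin.tail (prefixOf (g (K + 1)) (l + 1)))|)
        + ∑ i ∈ range K, (∑ a ∈ Ico (j - i) (K - i), ρ a) * (1 / (prof γ b (K - i) * sprof γ b (K - i)))
            * disc (g K) (g (K + 1)) i := by
    intro K j hj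
    refine (disc_le_sum_run (hrun K) (hrun (K + 1)) (hbox K) (hbox (K + 1)) ((hpin K).trans (hpin (K + 1)).symm)
      hL hΛ0 hj).trans (add_le_add le_rfl ?_)
    refine (feedback_le_column (δ := fun i => disc (g K) (g (K + 1)) i) hΛρ (fun i hi => ?_)
      (fun i => disc_nonneg _ _ _)).trans (Finset.sum_le_sum fun i hi => ?_)
    · have h1 := (hbox K i hi.le).1
      have h2 := (hbox (K + 1) (i + 1) (by omega)).1
      positivity
    · have hiK := Finset.mem_range.mp hi
      exact mul_le_mul_of_nonneg_right (mul_le_mul_of_nonneg_left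
        (weight_le hγ hb (hrun K) (hrun (K + 1)) (hbox K) (hbox (K + 1)) hlo hiK.le)
        (Finset.sum_nonneg fun a _ => hρ0 a)) (disc_nonneg _ _ _)
  exact diag_sum_le_uniform (δ := fun K j => disc (g K) (g (K + 1)) j)
    (σ := fun K l => |β (l + 1) (prefixOf (g (K + 1)) (l + 1)) - β l (Fin.tail (prefixOf (g (K + 1)) (l + 1)))|)
    (fun K j => disc_nonneg _ _ _) hρ0 (weight_nonneg hγ hb.le) (fun L m => hsrc L m) hρW
    (sum_weights_ir_le hγ hb) hsmall hrec m N

/-- **ROAD P3 — THE CONTINUUM COUPLING WITH m-UNIFORM CLOSENESS FROM A RUN-LEVEL SOURCE BOUND**: under the binders of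
`sum_disc_diag_le_run`, at every scale `m`: `invSq g m n → astar g m` and `|invSq g m n − astar g m| ≤ S₀∕(1 − W(γ³ + 2γ∕b))` for every
cutoff `n` — a closeness bound independent of BOTH the cutoff and the infrared distance (still no rate in the cutoff). [folklore] -/
theorem tendsto_invSq_diag_run {β : HBeta} {γ b S₀ W : ℝ} {ρ : ℕ → ℝ} {Λ : ℕ → ℕ → ℝ} (g : ℕ → ℕ → ℝ) (gIR : ℝ)
    (hγ : 0 < γ) (hb : 0 < b) (hρ0 : ∀ a, 0 ≤ ρ a) (hρW : ∀ n, ∑ a ∈ range n, ρ a ≤ W)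
    (hsmall : W * (γ ^ 3 + 2 * γ / b) < 1)
    (hrun : ∀ K, RGEqH K β (g K)) (hbox : ∀ K i, i ≤ K → 0 < g K i ∧ g K i ≤ γ) (hpin : ∀ K, g K K = gIR)
    (hL : HistLipschitz Λ γ β) (hΛ0 : ∀ k i, i ≤ k → 0 ≤ Λ k i) (hΛρ : ∀ k i, i ≤ k → Λ k i ≤ ρ (k - i))
    (hlo : BetaLowerH b γ β)
    (hsrc : ∀ L m, ∑ n ∈ range (L - m), ∑ l ∈ Ico n (n + m),
      |β (l + 1) (prefixOf (g (n + m + 1)) (l + 1)) - β l (Fin.tail (prefixOf (g (n + m + 1)) (l + 1)))| ≤ S₀)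
    (m : ℕ) :
    Tendsto (invSq g m) atTop (𝓝 (astar g m)) ∧ ∀ n, |invSq g m n - astar g m| ≤ S₀ / (1 - W * (γ ^ 3 + 2 * γ / b)) := by
  have hB := sum_disc_diag_le_run g gIR hγ hb hρ0 hρW hsmall hrun hbox hpin hL hΛ0 hΛρ hlo hsrc
  exact ⟨tendsto_invSq_of_diag_le (B := fun _ => S₀ / (1 - W * (γ ^ 3 + 2 * γ / b))) hB m,
    fun n => abs_invSq_sub_astar_le_of_diag_le (B := fun _ => S₀ / (1 - W * (γ ^ 3 + 2 * γ / b))) hB m n⟩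

end Summit.QuantumFields.BalabanUV.Beta.RemainderExplicitHistoryDiagonalUniform

end
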